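import Literature.Computability.AlgebraicComplexity.VPDeterminantalQPProofs
import Literature.Computability.AlgebraicComplexity.PfaffianLayeredABP
import HarnessLib

/-!
# Layered algebraic branching programs are inverse read-outs: `LayeredABPComputes m g → HasInvRepr g m`
# (hence `dc g ≤ m + 1`), and the Pfaffian has cubic determinantal complexity

A layered algebraic branching program (the tree's `LayeredABPComputes`, Andrews–Forbes 2022 §3.2
rendering: vertex set `Fin k`, `k ≤ m`, a layer function, an adjacency matrix `N` of affine labels
with every edge raising the layer by one, computed polynomial `(N ^ (ℓ(t) − ℓ(s))) s t`) is read out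
of the inverse of the unipotent matrix `1 − N`: this is the classical identity
`(1 − N)⁻¹ = Σ_i N^i` ("the `(s,t)` entry of `(I − A)⁻¹` is the sum of the weights of all `s–t`
paths", Valiant 1979 §2 / Bürgisser–Clausen–Shokrollahi 1997 proof of Thm. (21.27), property (C):
the matrices `[[α, 0], [A, β]]` with `A` unipotent), in which only the term `i = ℓ(t) − ℓ(s)`
survives because the program is layered. The tree's `HasInvRepr` (`VPDeterminantalQPProofs.lean`,
`g = vᵀ B⁻¹ w` with `det B = 1`, affine `B`, size `≤ m`) is exactly this shape, and
`HasInvRepr.hasDetRepr` (the Schur-complement bordering `[[B, −w], [vᵀ, 0]]`) turns it into an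
affine determinantal representation of size `m + 1`.

* `LayeredABPComputes.hasInvRepr` — **main bridge**: `LayeredABPComputes m g → HasInvRepr g m`
  (every commutative ring). Ingredients: `det (1 − N) = 1` because `1 − N` is block-triangular
  for the layer function with identity diagonal blocks (`Matrix.BlockTriangular.det`); `1 − N` is
  inverted by the geometric series (`mul_neg_geom_sum`, `N` is nilpotent: `(N ^ i) u v ≠ 0` forces
  `ℓ(v) = ℓ(u) + i`); the read-out vectors are the indicators of `s` and `t`.
* `LayeredABPComputes.hasDetRepr : LayeredABPComputes m g → HasDetRepr g (m + 1)` and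
  `LayeredABPComputes.determinantalComplexity_le : … → dc g ≤ m + 1`.
* `hasDetRepr_pfaffian` / `determinantalComplexity_pfaffian_le` — with the layered Pfaffian
  program of `PfaffianLayeredABP.lean` (`layeredABPComputes_pfaffian`, `16 t³` vertices, cell
  val-lit t16 g4): **`dc (Pf_{2t}) ≤ 16 t³ + 1`** over every commutative ring (`t ≥ 1`), the
  affine-determinant form of "the Pfaffian is in `VBP ⊆ VP_ws`" [MahajanSubramanyaVinay2004,
  Thm. 12].

Cell `val-lit`, seat t16 g5; theorem-only (no definitions, no named facts). Honest framing:
textbook linear algebra about branching programs; nothing here bears on `VP` versus `VNP`.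

## References

* L. G. Valiant, *Completeness classes in algebra*, STOC 1979, §2 (paths sums as entries of
  `(I − A)⁻¹`; universality of the determinant). [Valiant1979]
* P. Bürgisser, M. Clausen, M. A. Shokrollahi, *Algebraic Complexity Theory*, Springer 1997,
  Thm. (21.27) and its proof (properties (A)–(C)). [BurgisserClausenShokrollahi1997]
* R. Andrews, M. A. Forbes, STOC 2022 = arXiv:2112.00792, §3.2 (layered ABPs). [AndrewsForbes2022]
* M. Mahajan, P. R. Subramanya, V. Vinay, Discrete Appl. Math. 143 (2004), Thm. 12.
  [MahajanSubramanyaVinay2004]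
-/

noncomputable section

namespace Literature.Computability.AlgebraicComplexity

open MvPolynomial Finset
open _root_.Matrix

universe u v

variable {R : Type u} [CommRing R] {ι : Type v}

namespace LayeredABPComputes

/-! ## The adjacency matrix of a layered program: powers, nilpotency, unipotency of `1 − N` -/

section Adjacency

variable {k : ℕ} (layer : Fin k → ℕ) (N : Matrix (Fin k) (Fin k) (MvPolynomial ι R))

/-- In a layered program every walk of length `i` raises the layer by exactly `i`: a non-zero
entry `(N ^ i) u v` forces `ℓ(v) = ℓ(u) + i`. [cite: AndrewsForbes2022, §3.2 (layered ABPs)] -/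
theorem pow_apply_ne_zero (hN : ∀ u v, N u v ≠ 0 → layer v = layer u + 1) :
    ∀ (i : ℕ) (u v : Fin k), (N ^ i) u v ≠ 0 → layer v = layer u + i := by
  intro i
  induction i with
  | zero =>
    intro u v h
    rw [pow_zero] at h
    by_cases huv : u = v
    · subst huv; simp
    · exact absurd (Matrix.one_apply_ne huv) h
  | succ i ih =>
    intro u v h
    rw [pow_succ, Matrix.mul_apply] at h
    obtain ⟨w, -, hw⟩ := Finset.exists_ne_zero_of_sum_ne_zero h
    have h1 : (N ^ i) u w ≠ 0 := fun h0 => hw (by rw [h0, zero_mul])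
    have h2 : N w v ≠ 0 := fun h0 => hw (by rw [h0, mul_zero])
    rw [hN w v h2, ih u w h1]
    ring

/-- A layered program is nilpotent: `N ^ L = 0` as soon as `L` exceeds every layer.
[cite: AndrewsForbes2022, §3.2 (layered ABPs)] -/
theorem pow_eq_zero_of_lt (hN : ∀ u v, N u v ≠ 0 → layer v = layer u + 1) {L : ℕ}
    (hL : ∀ v, layer v < L) : N ^ L = 0 := by
  refine Matrix.ext fun u v => ?_
  rw [Matrix.zero_apply]
  by_contra h
  have := pow_apply_ne_zero layer N hN L u v h
  have := hL v
  omega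

/-- `1 − N` is block upper-triangular for the layer function (an edge never lowers the layer).
[cite: BurgisserClausenShokrollahi1997, Thm. (21.27) (proof, property (C))] -/
theorem blockTriangular_one_sub (hN : ∀ u v, N u v ≠ 0 → layer v = layer u + 1) :
    (1 - N).BlockTriangular layer := by
  intro u v huv
  have hne : u ≠ v := by rintro rfl; exact lt_irrefl _ huv
  have hz : N u v = 0 := by
    by_contra h
    have := hN u v h
    omega
  simp [Matrix.sub_apply, Matrix.one_apply_ne hne, hz]

/-- The diagonal blocks of `1 − N` (vertices of one layer) are identity matrices: there is no edge
inside a layer. [cite: BurgisserClausenShokrollahi1997, Thm. (21.27) (proof, property (C))] -/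
theorem toSquareBlock_one_sub (hN : ∀ u v, N u v ≠ 0 → layer v = layer u + 1) (a : ℕ) :
    (1 - N).toSquareBlock layer a = 1 := by
  ext ⟨u, hu⟩ ⟨v, hv⟩
  have hz : N u v = 0 := by
    by_contra h
    have := hN u v h
    omega
  by_cases huv : u = v
  · subst huv
    simp [Matrix.toSquareBlock_def, hz]
  · have hne : (⟨u, hu⟩ : {x // layer x = a}) ≠ ⟨v, hv⟩ := fun h => huv (congrArg Subtype.val h)
    simp [Matrix.toSquareBlock_def, Matrix.one_apply_ne huv, Matrix.one_apply_ne hne, hz]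

/-- **`det (1 − N) = 1`** for the adjacency matrix of a layered program (`1 − N` is unipotent:
block-triangular with identity diagonal blocks).
[cite: BurgisserClausenShokrollahi1997, Thm. (21.27) (proof, properties (A)–(C))] -/
theorem det_one_sub (hN : ∀ u v, N u v ≠ 0 → layer v = layer u + 1) : (1 - N).det = 1 := by
  classical
  rw [(blockTriangular_one_sub layer N hN).det]
  refine Finset.prod_eq_one fun a _ => ?_
  rw [toSquareBlock_one_sub layer N hN a, Matrix.det_one]

/-- **Geometric series**: `(1 − N)⁻¹ = Σ_{i < L} N^i` once `N ^ L = 0` ("the entries of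
`(I − A)⁻¹` are the path sums"). [cite: Valiant1979, §2] -/
theorem inv_one_sub_eq_sum (hN : ∀ u v, N u v ≠ 0 → layer v = layer u + 1) {L : ℕ}
    (hL : ∀ v, layer v < L) : (1 - N)⁻¹ = ∑ i ∈ Finset.range L, N ^ i := by
  have h : (1 - N) * ∑ i ∈ Finset.range L, N ^ i = 1 := by
    rw [mul_neg_geom_sum, pow_eq_zero_of_lt layer N hN hL, sub_zero]
  exact Matrix.inv_eq_right_inv h

/-- The `(s, t)` entry of `(1 − N)⁻¹` is the single surviving path sum `(N ^ (ℓ(t) − ℓ(s))) s t`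
(all `s–t` walks have length `ℓ(t) − ℓ(s)`). [cite: Valiant1979, §2] -/
theorem inv_one_sub_apply (hN : ∀ u v, N u v ≠ 0 → layer v = layer u + 1) (s t : Fin k) :
    (1 - N)⁻¹ s t = (N ^ (layer t - layer s)) s t := by
  set L : ℕ := (Finset.univ.sup layer) + 1 with hLdef
  have hL : ∀ v, layer v < L := fun v =>
    Nat.lt_succ_of_le (Finset.le_sup (f := layer) (Finset.mem_univ v))
  rw [inv_one_sub_eq_sum layer N hN hL, Matrix.sum_apply]
  have hvanish : ∀ i, i ≠ layer t - layer s → (N ^ i) s t = 0 := by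
    intro i hi
    by_contra h
    have := pow_apply_ne_zero layer N hN i s t h
    omega
  rw [Finset.sum_eq_single (layer t - layer s) (fun i _ hi => hvanish i hi)]
  intro hmem
  -- the surviving index is `< L`, so this case is vacuous
  exfalso
  refine hmem (Finset.mem_range.2 ?_)
  have := hL t
  omega

end Adjacency

/-! ## The bridge -/

/-- **A layered algebraic branching program on at most `m` vertices is an inverse read-out of size
at most `m`**: `LayeredABPComputes m g → HasInvRepr g m`. With `B = 1 − N` (affine entries,
`det B = 1`) and `v = e_s`, `w = e_t`: `vᵀ B⁻¹ w = ((1 − N)⁻¹)_{s t} = (N^{ℓ(t)−ℓ(s)})_{s t} = g`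
(Valiant 1979 §2; BCS 1997, proof of Thm. (21.27), property (C)). Every commutative ring.
[cite: BurgisserClausenShokrollahi1997, Thm. (21.27) (proof, property (C))] -/
theorem hasInvRepr {m : ℕ} {g : MvPolynomial ι R} (h : LayeredABPComputes m g) :
    HasInvRepr g m := by
  classical
  obtain ⟨k, hk, layer, s, t, N, hN, hdeg, hg⟩ := h
  refine ⟨Fin k, inferInstance, inferInstance, 1 - N, Pi.single s 1, Pi.single t 1,
    by simpa using hk, ?_, det_one_sub layer N hN, ?_⟩
  · -- affine entries
    intro i j
    rw [Matrix.sub_apply]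
    refine (totalDegree_sub _ _).trans (max_le ?_ (hdeg i j))
    by_cases hij : i = j
    · subst hij; simp
    · simp [Matrix.one_apply_ne hij]
  · -- the read-out
    have hv : (fun i => C (Pi.single (M := fun _ : Fin k => R) s 1 i)) =
        (Pi.single s 1 : Fin k → MvPolynomial ι R) := by
      funext i
      by_cases hi : i = s
      · subst hi; simp
      · simp [Pi.single_eq_of_ne hi]
    have hw : (fun j => C (Pi.single (M := fun _ : Fin k => R) t 1 j)) =
        (Pi.single t 1 : Fin k → MvPolynomial ι R) := by
      funext j
      by_cases hj : j = t
      · subst hj; simp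
      · simp [Pi.single_eq_of_ne hj]
    rw [hv, hw, Matrix.mulVec_single_one, single_one_dotProduct, Matrix.col_apply,
      inv_one_sub_apply layer N hN s t, hg]

/-- **`LayeredABPComputes m g → HasDetRepr g (m + 1)`**: a layered ABP on at most `m` vertices
gives an affine determinantal representation of size `m + 1` (bridge + the tree's Schur-complement
bordering `HasInvRepr.hasDetRepr`). [cite: BurgisserClausenShokrollahi1997, Thm. (21.27)] -/
theorem hasDetRepr {m : ℕ} {g : MvPolynomial ι R} (h : LayeredABPComputes m g) :
    HasDetRepr g (m + 1) :=
  (hasInvRepr h).hasDetRepr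

/-- **`dc g ≤ m + 1`** for a polynomial computed by a layered ABP on at most `m` vertices.
[cite: BurgisserClausenShokrollahi1997, Thm. (21.27)] -/
theorem determinantalComplexity_le {m : ℕ} {g : MvPolynomial ι R} (h : LayeredABPComputes m g) :
    determinantalComplexity g ≤ m + 1 :=
  determinantalComplexity_le_of_hasDetRepr (hasDetRepr h)

end LayeredABPComputes

/-! ## The Pfaffian has cubic determinantal complexity -/

/-- **`Pf_{2t} = det` of an affine matrix of size `16 t³ + 1`** (`t ≥ 1`, every commutative ring):
the layered Pfaffian program of `PfaffianLayeredABP.lean` (`16 t³` vertices, Rote's incremental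
recursion, [MSV04, Thm. 12] class) read through the bridge.
[cite: MahajanSubramanyaVinay2004, Theorem 12] -/
theorem hasDetRepr_pfaffian (R : Type*) [CommRing R] (t : ℕ) (ht : 1 ≤ t) :
    HasDetRepr (pfaffian (2 * t) (skewX R (2 * t))) (16 * t ^ 3 + 1) :=
  (layeredABPComputes_pfaffian R t ht).hasDetRepr

/-- **`dc (Pf_{2t}) ≤ 16 t³ + 1`** (`t ≥ 1`, every commutative ring) — the affine-determinant form
of "the Pfaffian is in `VBP`". [cite: MahajanSubramanyaVinay2004, Theorem 12] -/
theorem determinantalComplexity_pfaffian_le (R : Type*) [CommRing R] (t : ℕ) (ht : 1 ≤ t) :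
    determinantalComplexity (pfaffian (2 * t) (skewX R (2 * t))) ≤ 16 * t ^ 3 + 1 :=
  (layeredABPComputes_pfaffian R t ht).determinantalComplexity_le

end Literature.Computability.AlgebraicComplexity

end
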